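import Summits.CriticalPhenomena.PercolationContinuityZ3.Theorems.Transplant.SkelPhiCellsConcG
import Summits.CriticalPhenomena.PercolationContinuityZ3.Theorems.Transplant.SkelConcSchedule
import HarnessLib

/-!
# L3′ (part 4): the (D) radius schedule over the TWO-UNIT cells — φ-free twin of `KNCellsBoxProdZ2ConcScheduleG` (`concRadiiGOf`) and
# `SkelConcSchedule` (`concRadiiS`) for hp-8's `PCells2`, and its well-formedness `Skelφ.WFS2` (DPRIME-SCOPE §2 L3′, p3 addendum K)

builds on p205010 (kernel theorem, internal audit signed; external expert review pending) — nothing in this file uses p205010.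
Lane `prim-bschramm-*`, seat `prim-bschramm-p2` (gen 7); helper file (`--supports stmt-CriticalPhenomena-4575`).

The two source files are Φ-free but typed over the one-unit cells `C : PCells`; the two units enter in exactly TWO places: the base-row
threshold of the corridor profile `ρ a v δ ℓ` (`ℓ ≤ 5 r` ↦ `ℓ ≤ 5 r∥ = 5 · P.r δ.1`, the run-axis unit — `δ` is an argument of `ρ`) and the
column radius `off x = ‖cen x‖₁ + 1` (now `20 r₀ |x₀| + 20 r₁ |x₁| + 1`, dominated by the recursion under `20 · rmax ≤ gap n`).  Everything
else — the recursion `Erad/Frad`, the level indices `nQ/nS`, the arithmetic of §2 of the source (`Skel.E₀_le_Erad`, `Skel.Erad_succ_le_Erad_succ`,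
…) — is PCells-free and IMPORTED (K2.5).  Proofs are the sources', verbatim up to these substitutions.
* §1 `Skelφ.concRadii2Of P gap gap' E₀ L'` (+ `@[simp]` fields), **`concRadii2Of_WF2 : WF2 P (concRadii2Of …)`**, `ρ2_le`, `rE2_eq`, `ρ2_eq`;
* §2 `Skelφ.off2 P x`, **`Skelφ.concRadii2S P gap gap' E₀ L'`** (`rQ := E (nQ) ⊔ off2`, `rC := E (nQ + 4) ⊔ off2`, `rB := E (nQ (v+δ))`, `rE := rE_prod − 1`,
  `ρ := ρ_prod − 2`, `rM := F (nQ) − L'`) (+ `@[simp]` fields); §3 `off2_le_Erad (hgap : ∀ n, 20 · rmax ≤ gap n)`;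
* §4 **`concRadii2S_WFS2 (hgap : ∀ n, 1 ≤ gap n) (hE₀ : 2 ≤ E₀) (hL' : 1 ≤ L') : WFS2 P (concRadii2S P gap gap' E₀ L')`**;
* §5 realised values `concRadii2S_rE_eq / _ρ_eq / _ρ_le / _rQ_eq / _rC_eq / _rQ_eq_of_norm_le`.
[cite: KozmaNitzan2024, §4 pp. 25–27, 30–31 (Q_v, M_v, E_{v,x}, H^j_{v,x})]
-/

noncomputable section

open scoped Classical

namespace Summit.CriticalPhenomena.PercolationContinuityZ3.Theorems

namespace Transplant

namespace Skelφ

open Literature.Probability.Percolation Literature.Probability.LatticeModels SimpleGraph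
open BoxProdZ2 (ConcRadiiG Erad Frad nQ nS Erad_mono Frad_mono Frad_le_Erad Erad_lt_Frad_succ nQ_mono nQ_le_nQ_add_three nQ_add_le_nS_succ
  mem_pair Erad_pred_le_Frad)
open Skel (E₀_le_Erad E₀_le_Frad Erad_succ_le_Erad_succ Erad_succ_le_Erad_of_lt)

variable (P : PCells2) (gap gap' : ℕ → ℕ) (E₀ L' : ℕ)

/-! ## §1 The product-shaped schedule over the two-unit cells (twin of p3's `BoxProdZ2.concRadiiGOf`) -/

/-- **The (D) radius schedule** over the recursion `Erad` / `Frad`. [this work] -/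
def concRadii2Of : ConcRadiiG where
  rQ := fun a w => Erad gap gap' E₀ (nQ a w)
  rM := fun a w => Frad gap gap' E₀ (nQ a w) - L'
  rC := fun a w => Erad gap gap' E₀ (nQ a w + 3)
  rB := fun a v δ => Erad gap gap' E₀ (nQ a (v + stepVec δ))
  rE := fun a v δ => min (Frad gap gap' E₀ (nS a v + 1)) (Erad gap gap' E₀ (nQ a (v + stepVec δ)))
  ρ := fun a v δ ℓ =>
    if ℓ ≤ 5 * (P.r δ.1 : ℤ) then
      min (min (Erad gap gap' E₀ (nS a v)) (min (Frad gap gap' E₀ (nS a v + 1)) (Erad gap gap' E₀ (nQ a (v + stepVec δ)))))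
        (min (Erad gap gap' E₀ (nQ (a - 1) v)) (Erad gap gap' E₀ (nQ a v)))
    else min (Erad gap gap' E₀ (nS a v)) (min (Frad gap gap' E₀ (nS a v + 1)) (Erad gap gap' E₀ (nQ a (v + stepVec δ))))

/-- `rQ a w = E (nQ a w)`. [folklore] -/
@[simp] theorem concRadii2Of_rQ (a : ℕ) (w : Site 2) : (concRadii2Of P gap gap' E₀ L').rQ a w = Erad gap gap' E₀ (nQ a w) := rfl

/-- `rM a w = F (nQ a w) - L'`. [folklore] -/
@[simp] theorem concRadii2Of_rM (a : ℕ) (w : Site 2) : (concRadii2Of P gap gap' E₀ L').rM a w = Frad gap gap' E₀ (nQ a w) - L' := rfl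

/-- `rB a v δ = E (nQ a (v + δ))`. [folklore] -/
@[simp] theorem concRadii2Of_rB (a : ℕ) (v : Site 2) (δ : MDir) :
    (concRadii2Of P gap gap' E₀ L').rB a v δ = Erad gap gap' E₀ (nQ a (v + stepVec δ)) := rfl

/-- `rE a v δ = F (nS a v + 1) ⊓ E (nQ a (v + δ))`. [folklore] -/
theorem concRadii2Of_rE (a : ℕ) (v : Site 2) (δ : MDir) :
    (concRadii2Of P gap gap' E₀ L').rE a v δ = min (Frad gap gap' E₀ (nS a v + 1)) (Erad gap gap' E₀ (nQ a (v + stepVec δ))) := rfl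

/-- **The schedule is well formed** (all eight order families, for all indices). [this work] -/
theorem concRadii2Of_WF2 : WF2 P (concRadii2Of P gap gap' E₀ L') where
  QC a a' x h :=
    Erad_mono gap gap' E₀ ((nQ_mono (by rcases mem_pair h with rfl | rfl <;> omega) x).trans (Nat.le_add_right _ _))
  BC a a' v δ h := by
    refine Erad_mono gap gap' E₀ (nQ_le_nQ_add_three ?_ v _)
    rcases mem_pair h with rfl | rfl <;> omega
  BC' a a' v δ h := by
    refine Erad_mono gap gap' E₀ ?_
    have h1 : nQ a (v + stepVec δ) ≤ nQ a' (v + stepVec δ) := nQ_mono (by rcases mem_pair h with rfl | rfl <;> omega) _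
    omega
  ρQ a a' v δ ℓ h hℓ := by
    change (if ℓ ≤ 5 * (P.r δ.1 : ℤ) then _ else _) ≤ Erad gap gap' E₀ (nQ a v)
    rw [if_pos hℓ]
    rcases mem_pair h with rfl | rfl
    · exact (min_le_right _ _).trans (min_le_right _ _)
    · exact (min_le_right _ _).trans ((min_le_left _ _).trans (by simp))
  ρE a v δ ℓ := by
    change (if ℓ ≤ 5 * (P.r δ.1 : ℤ) then _ else _) ≤ min _ _
    split_ifs
    · exact (min_le_left _ _).trans (min_le_right _ _)
    · exact min_le_right _ _
  EB a v δ := min_le_right _ _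
  EQ a v δ := min_le_right _ _
  ME a v δ := by
    change Frad gap gap' E₀ (nQ a (v + stepVec δ)) - L' ≤ min _ _
    refine le_min ((Nat.sub_le _ _).trans (Frad_mono gap gap' E₀ (nQ_add_le_nS_succ a v δ))) ?_
    exact (Nat.sub_le _ _).trans (Frad_le_Erad gap gap' E₀ _)

/-! ## §3 Realised values -/

/-! ### Realised values of the product-shaped schedule -/

/-- The corridor profile never exceeds the own-cube radius `E (nS a v)`. [folklore] -/
theorem ρ2_le (a : ℕ) (v : Site 2) (δ : MDir) (ℓ : ℤ) : (concRadii2Of P gap gap' E₀ L').ρ a v δ ℓ ≤ Erad gap gap' E₀ (nS a v) := by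
  change (if ℓ ≤ 5 * (P.r δ.1 : ℤ) then _ else _) ≤ _
  split_ifs
  · exact (min_le_left _ _).trans (min_le_left _ _)
  · exact min_le_left _ _

/-- **Realised far-box radius**: when the next cube sits exactly one level above the own cube, `rE a v δ = F (nS a v + 1)`. [folklore] -/
theorem rE2_eq {a : ℕ} {v : Site 2} {δ : MDir} (h : nQ a (v + stepVec δ) = nS a v + 1) :
    (concRadii2Of P gap gap' E₀ L').rE a v δ = Frad gap gap' E₀ (nS a v + 1) := by
  rw [concRadii2Of_rE, h]
  exact min_eq_left (Frad_le_Erad gap gap' E₀ _)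

/-- **Realised corridor profile**: if the own-cube level is at most the next cube's and the previous-anchor cube's level at `v`, the profile
is the own-cube radius `E (nS a v)` at every level. [folklore] -/
theorem ρ2_eq {a : ℕ} {v : Site 2} {δ : MDir} (h1 : nS a v ≤ nQ a (v + stepVec δ)) (h2 : nS a v ≤ nQ (a - 1) v) (ℓ : ℤ) :
    (concRadii2Of P gap gap' E₀ L').ρ a v δ ℓ = Erad gap gap' E₀ (nS a v) := by
  have hA : Erad gap gap' E₀ (nS a v) ≤ min (Frad gap gap' E₀ (nS a v + 1)) (Erad gap gap' E₀ (nQ a (v + stepVec δ))) :=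
    le_min (by simpa using Erad_pred_le_Frad gap gap' E₀ (nS a v + 1)) (Erad_mono gap gap' E₀ h1)
  have hB : Erad gap gap' E₀ (nS a v) ≤ min (Erad gap gap' E₀ (nQ (a - 1) v)) (Erad gap gap' E₀ (nQ a v)) := by
    refine le_min (Erad_mono gap gap' E₀ h2) (Erad_mono gap gap' E₀ ?_)
    exact h2.trans (nQ_mono (Nat.sub_le a 1) v)
  change (if ℓ ≤ 5 * (P.r δ.1 : ℤ) then _ else _) = _
  split_ifs
  · rw [min_eq_left hA, min_eq_left hB]
  · exact min_eq_left hA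

/-! ## §2 The (D) schedule with the unit perturbations and the column radius (twin of `Skel.concRadiiS`) -/

/-- **The column radius** of the macro-cell `x`: the planar ℓ¹-offset of its centre plus one (`WFS.colQ`). [this work] -/
def off2 (x : Site 2) : ℕ := (P.cen x 0).natAbs + (P.cen x 1).natAbs + 1

/-- **The (D) radius schedule over a planar skeleton** (ruling stmt-g7 18:38:47Z / p3-g4 18:39:38Z (B)). [this work] -/
def concRadii2S : ConcRadiiG where
  rQ := fun a w => max (Erad gap gap' E₀ (nQ a w)) (off2 P w)
  rM := fun a w => Frad gap gap' E₀ (nQ a w) - L'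
  rC := fun a w => max (Erad gap gap' E₀ (nQ a w + 4)) (off2 P w)
  rB := fun a v δ => Erad gap gap' E₀ (nQ a (v + stepVec δ))
  rE := fun a v δ => (concRadii2Of P gap gap' E₀ L').rE a v δ - 1
  ρ := fun a v δ ℓ => (concRadii2Of P gap gap' E₀ L').ρ a v δ ℓ - 2

/-- `rQ a w = E (nQ a w) ⊔ off w`. [folklore] -/
@[simp] theorem concRadii2S_rQ (a : ℕ) (w : Site 2) : (concRadii2S P gap gap' E₀ L').rQ a w = max (Erad gap gap' E₀ (nQ a w)) (off2 P w) := rfl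

/-- `rC a w = E (nQ a w + 4) ⊔ off w`. [folklore] -/
@[simp] theorem concRadii2S_rC (a : ℕ) (w : Site 2) :
    (concRadii2S P gap gap' E₀ L').rC a w = max (Erad gap gap' E₀ (nQ a w + 4)) (off2 P w) := rfl

/-- `rM a w = F (nQ a w) - L'` (unchanged). [folklore] -/
@[simp] theorem concRadii2S_rM (a : ℕ) (w : Site 2) : (concRadii2S P gap gap' E₀ L').rM a w = Frad gap gap' E₀ (nQ a w) - L' := rfl

/-- `rB a v δ = E (nQ a (v + δ))` (thick between-box, unchanged). [folklore] -/
@[simp] theorem concRadii2S_rB (a : ℕ) (v : Site 2) (δ : MDir) :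
    (concRadii2S P gap gap' E₀ L').rB a v δ = Erad gap gap' E₀ (nQ a (v + stepVec δ)) := rfl

/-- `rE a v δ = rE_prod a v δ - 1`. [folklore] -/
@[simp] theorem concRadii2S_rE (a : ℕ) (v : Site 2) (δ : MDir) :
    (concRadii2S P gap gap' E₀ L').rE a v δ = (concRadii2Of P gap gap' E₀ L').rE a v δ - 1 := rfl

/-- `ρ a v δ ℓ = ρ_prod a v δ ℓ - 2`. [folklore] -/
@[simp] theorem concRadii2S_ρ (a : ℕ) (v : Site 2) (δ : MDir) (ℓ : ℤ) :
    (concRadii2S P gap gap' E₀ L').ρ a v δ ℓ = (concRadii2Of P gap gap' E₀ L').ρ a v δ ℓ - 2 := rfl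


/-! ## §3 The planar offset is dominated by the recursion -/

variable {gap}



/-- **The planar offset is dominated by the recursion**: `20 rmax ≤ gap n` everywhere and `1 ≤ E₀` give `off2 x ≤ E k` whenever `‖x‖₁ ≤ k` —
so the max in `rQ`/`rC` is inactive at every pair a run visits (`KNCells2AnchorNorm`: `‖x‖₁ ≤ nQ a x` there). [this work] -/
theorem off2_le_Erad (hgap : ∀ n, 20 * P.rmax ≤ gap n) (hE₀ : 1 ≤ E₀) {x : Site 2} {k : ℕ} (hk : (x 0).natAbs + (x 1).natAbs ≤ k) :
    off2 P x ≤ Erad gap gap' E₀ k := by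
  -- `E₀ + 20 r k ≤ E k`
  have key : ∀ k, E₀ + 20 * P.rmax * k ≤ Erad gap gap' E₀ k := by
    intro k
    induction k with
    | zero => simp
    | succ k ih =>
      have h1 : Erad gap gap' E₀ k + gap (Erad gap gap' E₀ k) ≤ Erad gap gap' E₀ (k + 1) :=
        (BoxProdZ2.Erad_add_gap_le_Frad_succ gap gap' E₀ k).trans (Frad_le_Erad gap gap' E₀ _)
      have h2 := hgap (Erad gap gap' E₀ k)
      nlinarith
  have h0 : (P.cen x 0).natAbs = 20 * P.r 0 * (x 0).natAbs := by
    rw [PCells2.cen_apply, Int.natAbs_mul, Int.natAbs_mul]; simp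
  have h1 : (P.cen x 1).natAbs = 20 * P.r 1 * (x 1).natAbs := by
    rw [PCells2.cen_apply, Int.natAbs_mul, Int.natAbs_mul]; simp
  unfold off2
  rw [h0, h1]
  have := key k
  have hr0 := P.r_le_rmax 0
  have hr1 := P.r_le_rmax 1
  have hm0 : 20 * P.r 0 * (x 0).natAbs ≤ 20 * P.rmax * (x 0).natAbs :=
    Nat.mul_le_mul_right _ (Nat.mul_le_mul_left _ hr0)
  have hm1 : 20 * P.r 1 * (x 1).natAbs ≤ 20 * P.rmax * (x 1).natAbs :=
    Nat.mul_le_mul_right _ (Nat.mul_le_mul_left _ hr1)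
  have hmono : 20 * P.rmax * ((x 0).natAbs + (x 1).natAbs) ≤ 20 * P.rmax * k := Nat.mul_le_mul_left _ hk
  nlinarith


variable (gap)


/-! ## §4 Well-formedness with slack -/


/-- **The schedule satisfies `WFS`** (every `gap ≥ 1`, `E₀ ≥ 2`, `L' ≥ 1`). [this work] -/
theorem concRadii2S_WFS2 (hgap : ∀ n, 1 ≤ gap n) (hE₀ : 2 ≤ E₀) (hL' : 1 ≤ L') : WFS2 P (concRadii2S P gap gap' E₀ L') := by
  have W := concRadii2Of_WF2 P gap gap' E₀ L'
  -- product facts, restated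
  have hBC : ∀ a a' v δ, a' ∈ ({a, a + 1} : Finset ℕ) →
      Erad gap gap' E₀ (nQ a' (v + stepVec δ)) ≤ Erad gap gap' E₀ (nQ a v + 3) := fun a a' v δ h => W.BC a a' v δ h
  have hBC' : ∀ a a' v δ, a' ∈ ({a, a + 1} : Finset ℕ) →
      Erad gap gap' E₀ (nQ a (v + stepVec δ)) ≤ Erad gap gap' E₀ (nQ a' (v + stepVec δ) + 3) := fun a a' v δ h => W.BC' a a' v δ h
  have hρQ : ∀ a a' v δ ℓ, a' ∈ ({a, a + 1} : Finset ℕ) → ℓ ≤ 5 * (P.r δ.1 : ℤ) →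
      (concRadii2Of P gap gap' E₀ L').ρ a' v δ ℓ ≤ Erad gap gap' E₀ (nQ a v) := fun a a' v δ ℓ h hℓ => W.ρQ a a' v δ ℓ h hℓ
  have hρE : ∀ a v δ ℓ, (concRadii2Of P gap gap' E₀ L').ρ a v δ ℓ ≤ (concRadii2Of P gap gap' E₀ L').rE a v δ := W.ρE
  have hEB : ∀ a v δ, (concRadii2Of P gap gap' E₀ L').rE a v δ ≤ Erad gap gap' E₀ (nQ a (v + stepVec δ)) := W.EB
  have hME : ∀ a v δ, Frad gap gap' E₀ (nQ a (v + stepVec δ)) - L' ≤ (concRadii2Of P gap gap' E₀ L').rE a v δ := W.ME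
  have h34 : ∀ a v, Erad gap gap' E₀ (nQ a v + 3) + 1 ≤ Erad gap gap' E₀ (nQ a v + 4) :=
    fun a v => Erad_succ_le_Erad_succ gap' E₀ hgap _
  have hE2 : ∀ n, 2 ≤ Erad gap gap' E₀ n := fun n => hE₀.trans (E₀_le_Erad gap gap' E₀ n)
  have hrE2 : ∀ a v δ, 2 ≤ (concRadii2Of P gap gap' E₀ L').rE a v δ := fun a v δ => by
    rw [concRadii2Of_rE]
    exact le_min (hE₀.trans (E₀_le_Frad gap gap' E₀ _)) (hE2 _)
  have hMF : ∀ a v δ, Frad gap gap' E₀ (nQ a (v + stepVec δ)) ≤ (concRadii2Of P gap gap' E₀ L').rE a v δ := fun a v δ => by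
    rw [concRadii2Of_rE]
    exact le_min (Frad_mono gap gap' E₀ (nQ_add_le_nS_succ a v δ)) (Frad_le_Erad gap gap' E₀ _)
  refine ⟨⟨?_, ?_, ?_, ?_, ?_, ?_, ?_, ?_⟩, ?_, ?_, ?_, ?_, ?_, ?_, ?_⟩
  · -- QC
    intro a a' x h
    simp only [concRadii2S_rQ, concRadii2S_rC]
    exact max_le_max (Erad_mono gap gap' E₀ ((nQ_mono (by rcases mem_pair h with rfl | rfl <;> omega) x).trans (Nat.le_add_right _ _)))
      le_rfl
  · -- BC
    intro a a' v δ h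
    simp only [concRadii2S_rB, concRadii2S_rC]
    exact le_max_of_le_left ((hBC a a' v δ h).trans (by have := h34 a v; omega))
  · -- BC'
    intro a a' v δ h
    simp only [concRadii2S_rB, concRadii2S_rC]
    exact le_max_of_le_left ((hBC' a a' v δ h).trans (by have := h34 a' (v + stepVec δ); omega))
  · -- ρQ
    intro a a' v δ ℓ h hℓ
    simp only [concRadii2S_ρ, concRadii2S_rQ]
    exact le_max_of_le_left ((Nat.sub_le _ _).trans (hρQ a a' v δ ℓ h hℓ))
  · -- ρE
    intro a v δ ℓ
    simp only [concRadii2S_ρ, concRadii2S_rE]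
    have := hρE a v δ ℓ; omega
  · -- EB
    intro a v δ
    simp only [concRadii2S_rE, concRadii2S_rB]
    exact (Nat.sub_le _ _).trans (hEB a v δ)
  · -- EQ
    intro a v δ
    simp only [concRadii2S_rE, concRadii2S_rQ]
    exact le_max_of_le_left ((Nat.sub_le _ _).trans (hEB a v δ))
  · -- ME
    intro a v δ
    simp only [concRadii2S_rM, concRadii2S_rE]
    have := hMF a v δ; have := hrE2 a v δ; omega
  · -- BC1
    intro a a' v δ h
    simp only [concRadii2S_rB, concRadii2S_rC]
    exact le_max_of_le_left ((Nat.add_le_add_right (hBC a a' v δ h) 1).trans (h34 a v))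
  · -- BC1'
    intro a a' v δ h
    simp only [concRadii2S_rB, concRadii2S_rC]
    exact le_max_of_le_left ((Nat.add_le_add_right (hBC' a a' v δ h) 1).trans (h34 a' (v + stepVec δ)))
  · -- ρQ1
    intro a a' v δ ℓ h hℓ
    simp only [concRadii2S_ρ, concRadii2S_rQ]
    refine le_max_of_le_left ?_
    have := hρQ a a' v δ ℓ h hℓ; have := hE2 (nQ a v); omega
  · -- ρE1
    intro a v δ ℓ
    simp only [concRadii2S_ρ, concRadii2S_rE]
    have := hρE a v δ ℓ; have := hrE2 a v δ; omega
  · -- EB1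
    intro a v δ
    simp only [concRadii2S_rE, concRadii2S_rB]
    have := hEB a v δ; have := hrE2 a v δ; omega
  · -- EQ1
    intro a v δ
    simp only [concRadii2S_rE, concRadii2S_rQ]
    refine le_max_of_le_left ?_
    have := hEB a v δ; have := hrE2 a v δ; omega
  · -- colQ
    intro a x
    simp only [concRadii2S_rQ]
    exact le_max_right _ _

/-! ## §5 Realised values (the product's shape, shifts explicit) -/

/-- **Realised far-box radius**: `rE a v δ = F (nS a v + 1) − 1` when the next cube is one level up. [folklore] -/
theorem concRadii2S_rE_eq {a : ℕ} {v : Site 2} {δ : MDir} (h : nQ a (v + stepVec δ) = nS a v + 1) :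
    (concRadii2S P gap gap' E₀ L').rE a v δ = Frad gap gap' E₀ (nS a v + 1) - 1 := by
  rw [concRadii2S_rE, rE2_eq P gap gap' E₀ L' h]

/-- **Realised corridor profile**: `ρ a v δ ℓ = E (nS a v) − 2` under the product's two order hypotheses. [folklore] -/
theorem concRadii2S_ρ_eq {a : ℕ} {v : Site 2} {δ : MDir} (h1 : nS a v ≤ nQ a (v + stepVec δ)) (h2 : nS a v ≤ nQ (a - 1) v) (ℓ : ℤ) :
    (concRadii2S P gap gap' E₀ L').ρ a v δ ℓ = Erad gap gap' E₀ (nS a v) - 2 := by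
  rw [concRadii2S_ρ, ρ2_eq P gap gap' E₀ L' h1 h2 ℓ]

/-- The corridor profile never exceeds `E (nS a v) − 2`. [folklore] -/
theorem concRadii2S_ρ_le (a : ℕ) (v : Site 2) (δ : MDir) (ℓ : ℤ) :
    (concRadii2S P gap gap' E₀ L').ρ a v δ ℓ ≤ Erad gap gap' E₀ (nS a v) - 2 := by
  rw [concRadii2S_ρ]; exact Nat.sub_le_sub_right (ρ2_le P gap gap' E₀ L' a v δ ℓ) 2

/-- **Realised cube radius**: the max is inactive once `off x ≤ E (nQ a x)`. [folklore] -/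
theorem concRadii2S_rQ_eq {a : ℕ} {x : Site 2} (h : off2 P x ≤ Erad gap gap' E₀ (nQ a x)) :
    (concRadii2S P gap gap' E₀ L').rQ a x = Erad gap gap' E₀ (nQ a x) := by
  rw [concRadii2S_rQ, max_eq_left h]

/-- **Realised cell radius**: the max is inactive once `off x ≤ E (nQ a x + 4)`. [folklore] -/
theorem concRadii2S_rC_eq {a : ℕ} {x : Site 2} (h : off2 P x ≤ Erad gap gap' E₀ (nQ a x + 4)) :
    (concRadii2S P gap gap' E₀ L').rC a x = Erad gap gap' E₀ (nQ a x + 4) := by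
  rw [concRadii2S_rC, max_eq_left h]

/-- **Realised cube radius at a pair with `‖x‖₁ ≤ nQ a x`** (every run pair, `KNCells2AnchorNorm`), under `20 r ≤ gap`, `1 ≤ E₀`. [this work] -/
theorem concRadii2S_rQ_eq_of_norm_le (hgap : ∀ n, 20 * P.rmax ≤ gap n) (hE₀ : 1 ≤ E₀) {a : ℕ} {x : Site 2}
    (hx : (x 0).natAbs + (x 1).natAbs ≤ nQ a x) : (concRadii2S P gap gap' E₀ L').rQ a x = Erad gap gap' E₀ (nQ a x) :=
  concRadii2S_rQ_eq P gap gap' E₀ L' (off2_le_Erad P gap' E₀ hgap hE₀ hx)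


end Skelφ

end Transplant

end Summit.CriticalPhenomena.PercolationContinuityZ3.Theorems

end
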